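import Mathlib.CategoryTheory.Adjunction.Basic
import Mathlib.CategoryTheory.Limits.Constructions.Over.Basic
import Literature.AnabelianGeometry.Anabelioids.Basic

/-!
# Slim anabelioids: [GeoAn] Proposition 1.2.5

Mochizuki, *The geometry of anabelioids*, Publ. RIMS **40** (2004), §1.2, Proposition 1.2.5 (Slim
Anabelioids), author's manuscript pp. 18–19 [cite: MochizukiGeoAn2004, Prop. 1.2.5 pp.18-19]:
"Let `X` be a slim anabelioid.  Then: (i) The pull-back and extension functors associated to a finite
étale morphism between slim anabelioids are rigid.  In particular, … `Et(X)` is slim. … (ii) The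
functor `F_X : X → Ét(X)`, `S ↦ (X_S → X)` is an equivalence (i.e., fully faithful and essentially
surjective)."  Both parts are NAMED FACTS, over `Anabelioids/Basic.lean` (connected anabelioid =
`GaloisCategory`, morphism = exact functor in the opposite direction, `IsFiniteEtale`, `IsSlim`,
rigid functor = the tree's `Frobenioids.IsRigidFunctor`).

Rendering of (ii).  `Ét(X) = |Et(X)|` is the coarsification (isomorphism classes of 1-morphisms over
`X`) of the 2-category of finite étale `Y → X`; rather than building that quotient category we state
its two halves on the nose: essential surjectivity of `F_X` is Definition 1.2.2 (i) itself ("follows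
formally", p. 19) and is not re-asserted; full faithfulness says that every finite étale 1-morphism
`X_S → X_T` over `X` (an exact `Q : X_T ⥤ X_S`, finite étale, with `i_T^* ⋙ Q ≅ i_S^*`) is isomorphic
to `f^* = Over.pullback f` for a unique `f : S → T`.
-/

namespace Literature.AnabelianGeometry.Anabelioids

open CategoryTheory CategoryTheory.Limits CategoryTheory.PreGaloisCategory
open Literature.AlgebraicGeometry.Frobenioids (IsRigidFunctor)

universe v₁ v₂ u₁ u₂

/-- NAMED FACT, [GeoAn] Proposition 1.2.5 (i): for a finite étale morphism `φ : Y → X` between slim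
connected anabelioids, the pull-back functor `φ^*` and the extension functor `φ_!` (its left adjoint,
Def. 1.2.2 (ii)) are rigid — "In particular, … `Et(X)` is slim" (every finite étale 1-morphism over
`X` is rigid, which is this statement applied to `Y₁ → Y₂`).
[cite: MochizukiGeoAn2004, Prop. 1.2.5(i) p.18] -/
def proposition_1_2_5_i : Prop :=
  ∀ (X : Type u₁) [Category.{v₁} X] (Y : Type u₂) [Category.{v₂} Y] [GaloisCategory X]
    [GaloisCategory Y], IsSlim X → IsSlim Y → ∀ (P : X ⥤ Y), IsFiniteEtale P →
    IsRigidFunctor P ∧ ∀ (L : Y ⥤ X), (L ⊣ P) → IsRigidFunctor L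

/-- NAMED FACT, [GeoAn] Proposition 1.2.5 (ii), full faithfulness of `F_X : X → Ét(X)`,
`S ↦ (X_S → X)` for a slim connected anabelioid `X`: every finite étale 1-morphism `X_S → X_T` over
`X` — an exact functor `Q : X_T ⥤ X_S` that is finite étale and 1-commutes with the structure
morphisms (`i_T^* ⋙ Q ≅ i_S^*`, `i^* = Over.star`) — is isomorphic to `f^* = Over.pullback f` for a
unique `f : S → T` (essential surjectivity of `F_X` being Def. 1.2.2 (i) itself).
[cite: MochizukiGeoAn2004, Prop. 1.2.5(ii) p.19] -/
def proposition_1_2_5_ii : Prop :=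
  ∀ (X : Type u₁) [Category.{v₁} X] [GaloisCategory X], IsSlim X →
    ∀ (S T : X) (Q : Over T ⥤ Over S) [PreservesFiniteLimits Q] [PreservesFiniteColimits Q],
      IsFiniteEtale Q → Nonempty (Over.star T ⋙ Q ≅ Over.star S) →
        ∃! f : S ⟶ T, Nonempty (Q ≅ Over.pullback f)

end Literature.AnabelianGeometry.Anabelioids
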